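import Mathlib
import Summits.QuantumAdvantage.QuantumAdvantage.Theses.LinnikCubicClassGroups

/-!
# Crux-ideate sketch (round 1, ideator 1) for `PureCubicClassNumberHard` (stmt-QuantumAdvantage-11826)

Card `thin-regulator-transfer`: sub-family antitonicity (proved glue) + the Nagell thin-regulator
family `m = n³ + 1`, on which the classical regulator/infrastructure obstruction is absent.
-/

namespace Summit.QuantumAdvantage.QuantumAdvantage.Cruxes.PureCubicClassNumberHard.Ideator1

open Literature.Computability.Complexity

/-- Hardness of the crux's task restricted to radicands `m = decodeNat x` lying in `S`
(same machine model, same output window, same success threshold as the crux). -/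
def ClassNumberHardOn (S : Set ℕ) : Prop :=
  ¬ ∃ A : RandAlg (List Bool) (List Bool), A.IsPolyTime id id ∧
    ∀ (x : List Bool) (K : Type) [Field K] [NumberField K], Module.finrank ℚ K = 3 →
      Computability.decodeNat x ∈ S →
      (∀ r : ℕ, r ^ 3 ≠ Computability.decodeNat x) →
      (∃ α : K, α ^ 3 = (Computability.decodeNat x : K)) →
      (2 : ℝ) / 3 ≤ A.pr id x {List.ofFn (fun i : Fin (2 * x.length + 8) =>
        (NumberField.classNumber K).testBit i.val)}

/-- SUB-FAMILY ANTITONICITY (proved glue): hardness on any set of radicands implies the crux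
verbatim. -/
theorem crux_of_hardOn (S : Set ℕ) (h : ClassNumberHardOn S) :
    Theses.LinnikCubicClassGroups.PureCubicClassNumberHard := by
  rintro ⟨A, hA, hall⟩
  exact h ⟨A, hA, fun x K _ _ hdeg _ hnc hα => hall x K hdeg hnc hα⟩

/-- The full family is the crux itself (sanity: the restriction to `Set.univ` loses nothing). -/
theorem hardOn_univ_iff :
    ClassNumberHardOn Set.univ ↔ Theses.LinnikCubicClassGroups.PureCubicClassNumberHard := by
  constructor
  · exact crux_of_hardOn _
  · rintro h ⟨A, hA, hall⟩
    exact h ⟨A, hA, fun x K _ _ hdeg hnc hα => hall x K hdeg (Set.mem_univ _) hnc hα⟩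

/-- The Nagell thin-regulator family `m = n³ + 1`, `n ≥ 2` (never a cube; `ℚ(∛m)` carries the unit
`∛m − n` of norm `1`, so its regulator is `≤ log(3n² + 3n + 1)`). -/
def nagellFamily : Set ℕ := {m | ∃ n : ℕ, 2 ≤ n ∧ m = n ^ 3 + 1}

/-- C⁺ of the card: the crux's hardness hypothesis localised to the Nagell family. -/
def ThinRegulatorClassNumberHard : Prop := ClassNumberHardOn nagellFamily

/-- The transfer `C⁺ → crux` (proved). -/
theorem crux_of_thin (h : ThinRegulatorClassNumberHard) :
    Theses.LinnikCubicClassGroups.PureCubicClassNumberHard := crux_of_hardOn _ h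

/-- Nagell's unit, ring-theoretic core: `α³ = n³ + 1 ⇒ (α − n)(α² + nα + n²) = 1`. -/
theorem nagell_unit {R : Type*} [CommRing R] (α : R) (n : ℕ) (h : α ^ 3 = (n : R) ^ 3 + 1) :
    (α - n) * (α ^ 2 + n * α + (n : R) ^ 2) = 1 := by
  linear_combination h

/-- Members of the Nagell family are never perfect cubes (so the crux's non-cube guard is automatic
and a cubic field containing `∛m` exists). -/
theorem nagellFamily_not_cube {m : ℕ} (hm : m ∈ nagellFamily) (r : ℕ) : r ^ 3 ≠ m := by
  obtain ⟨n, hn, rfl⟩ := hm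
  intro h
  rcases Nat.lt_or_ge n r with hlt | hle
  · have h1 : (n + 1) ^ 3 ≤ r ^ 3 := Nat.pow_le_pow_left hlt 3
    have h2 : (n + 1) ^ 3 = n ^ 3 + 3 * n ^ 2 + 3 * n + 1 := by ring
    nlinarith [h1, h2, h]
  · have := Nat.pow_le_pow_left hle 3
    omega

/-- FIRST CHECKABLE LEMMA OF THE LINE (stated, not proved here): on the Nagell family the regulator
is logarithmic in the input — `R(ℚ(∛(n³+1))) ≤ log(3n² + 3n + 1)` — because `ε = α² + nα + n²`
is a unit `> 1` with `ε < 3n² + 3n + 1` under the real embedding and `R = log ε₀ ≤ log ε`.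
(Nagell: `ε` is even fundamental except `m = 28`; Rudman 1973 Thm 1 for the wider family
`m = D³ + d`, `d ∣ 3D²`.) -/
def ThinRegulator : Prop :=
  ∀ n : ℕ, 2 ≤ n → ∀ (K : Type) [Field K] [NumberField K], Module.finrank ℚ K = 3 →
    (∃ α : K, α ^ 3 = ((n ^ 3 + 1 : ℕ) : K)) →
      NumberField.Units.regulator K ≤ Real.log (3 * (n : ℝ) ^ 2 + 3 * n + 1)

/-- ARTIN'S INEQUALITY consequence (stated): a cubic field with one real place and a unit of
infinite order has `|disc K| < 4 e^{3R} + 24`, so `R ≥ (1/3) log((|D_K| − 24)/4)`; on the Nagell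
family this pins the index of Nagell's unit in `𝓞_K^× / torsion` to `≤ 2` for large `n`. -/
def ArtinRegulatorLowerBound : Prop :=
  ∀ (K : Type) [Field K] [NumberField K], Module.finrank ℚ K = 3 →
    NumberField.InfinitePlace.nrRealPlaces K = 1 →
      ((|NumberField.discr K| : ℝ) - 24) / 4 ≤ Real.exp (3 * NumberField.Units.regulator K)

end Summit.QuantumAdvantage.QuantumAdvantage.Cruxes.PureCubicClassNumberHard.Ideator1
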